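import Literature.Analysis.FluidPDE.TorusBKMGradientLogBound
import Literature.Analysis.FluidPDE.TorusStrainVorticityIsometry
import Literature.Analysis.FluidPDE.TorusPalinstrophyLadder
import Literature.Analysis.FluidPDE.DoeringFoiasPowerProofs
import Literature.Analysis.FunctionSpaces.TorusConvectionGradNormSq
import Literature.Analysis.FunctionSpaces.TorusConvectionLaplacianNormSq
import HarnessLib

/-!
# Doering–Gibbon's Theorem 7.5: `‖Du‖_∞ ≤ c‖ω‖_∞[1 + log⁺ κ_{3,r}] + ‖ω‖₂` on `T³` (`r = 1, 2`)

Analysis/FluidPDE proof file (theorems only, no definitions, no named facts), sequel of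
`TorusBKMGradientLogBound`. Doering–Gibbon 1995, Thm. 7.5 (stated and proved for the periodic
domain `[0, L]³`; "first proved by Beale, Kato, and Majda"): for `N ≥ 3` and `0 ≤ r < N`,

  `‖Du‖_∞ ≤ c ‖ω‖_∞ [1 + log⁺(L κ_{N,r})] + L^{-3/2} ‖ω‖₂`,   `κ_{N,r} = (H_N/H_r)^{1/(2(N−r))}`,

`H_N = ∫ |∇^N u|²` the Sobolev seminorms of the (mean-zero) velocity. We prove the two cases used
by the Functional-Mining cell, on the unit torus (`L = 1`), for smooth divergence-free mean-zero
`u : T³ → ℝ³`, with `‖Du‖_∞` the sup of the Frobenius norm `(∑ᵢ‖∂ᵢu(x)‖²)^{1/2}`, `‖ω‖_∞` any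
pointwise majorant `Ω` of `|curl u|` (`torusVorticitySqAt u ≤ Ω²`), `‖ω‖₂² = ∫ |curl u|²`:

* `Torus.exists_sqrt_gradSq_le_bkm_kappa31` — `N = 3`, `r = 1`:
  `log⁺ κ_{3,1} = ¼ log⁺(H₃/H₁)` with `H₁ = ‖∇u‖₂² = Torus.gradNormSq u` (`= 2ℰ`) and
  `H₃ = ‖∇Δu‖₂² = Torus.gradNormSq (Δu)` (`= D₃`);
* `Torus.exists_sqrt_gradSq_le_bkm_kappa32` — `N = 3`, `r = 2`:
  `log⁺ κ_{3,2} = ½ log⁺(H₃/H₂)` with `H₂ = ‖Δu‖₂² = ∫ ‖Δu‖²` (`= 𝒫`, the palinstrophy);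
* `Torus.exists_gradSq_le_sq_bkm_posLog_ratio` — the `r = 2` case in the majorant form consumed by the
  Functional-Mining cell (`BKMLogGradientBound c` at `d := Fin 3`): no mean condition (the estimate is
  invariant under `u ↦ u + const`), squared, `‖ω‖₂ ≤ ‖ω‖_∞` absorbed:
  `∑ᵢ‖∂ᵢu(x)‖² ≤ (c Ω (1 + log⁺(H₃/H₂)))²`.

Here `log⁺ a = max 0 (log a)`. Both follow from the homogeneous form
`Torus.exists_sqrt_gradSq_le_bkm_log_homogeneous` (`|∇u|_F ≤ C(Ω(1 + log(1 + √H₃/Ω)) + ‖u‖₂)`) by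
`‖u‖₂ ≤ ‖∇u‖₂/(2π) ≤ ‖ω‖₂/(2π) ≤ Ω` (Poincaré for mean-zero fields, `‖∇u‖₂ = ‖ω‖₂` for
divergence-free fields, `|T³| = 1`) and `√H₃/Ω ≤ √(H₃/H₁) = κ_{3,1}² ≤ H₃/H₂ = κ_{3,2}²`
(`Ω² ≥ H₁` and the interpolation `H₂² ≤ H₁H₃`, `Torus.sq_integral_norm_sq_laplacian_le`). The printed
lower-order term `‖ω‖₂` is kept for fidelity (on the unit torus it is itself `≤ ‖ω‖_∞`).
-- TODO(general form): `N > 3` and `3 ≤ r < N` follow from these by the monotonicity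
-- `κ_{N,r} ≤ κ_{N+1,r}`, `κ_{N,r} ≤ κ_{N,r+1}` (Doering–Gibbon 1995, Ch. 6 exercises), once the tree
-- carries the general seminorms `H_N`.

## Mathlib / tree search

Tree (all used): `Torus.exists_sqrt_gradSq_le_bkm_log_homogeneous` (`TorusBKMGradientLogBound`);
`FluidPDE.integral_torusVorticitySqAt_eq_two_mul_torusEnstrophy` (`TorusStrainVorticityIsometry`),
`FluidPDE.gradNormSq_eq_two_mul_torusEnstrophy` (`ExtremeGrowthBounds`);
`Torus.sq_integral_norm_sq_laplacian_le` (`TorusPalinstrophyLadder`, DG95 Lemma 6.2);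
`FluidPDE.ofReal_integral_norm_sq_le_eGradNormSq_add` (`DoeringFoiasPowerProofs`, spectral Poincaré),
`Torus.gradNormSq_eq_toReal_eGradNormSq_holds`, `Torus.eGradNormSq_lt_top` (`TorusFourierCalculus`);
`Torus.integral_sum_sum_norm_partialDeriv_partialDeriv_sq_eq` (`TorusConvectionGradNormSq`),
`Torus.hasZeroMean_partialDeriv` (`TorusConvectionLaplacianNormSq`). Mathlib:
`integral_eq_zero_iff_of_nonneg`, `Continuous.ae_eq_iff_eq`, `Real.log_le_sub_one_of_pos`.

## References

* C. R. Doering, J. D. Gibbon, *Applied Analysis of the Navier–Stokes Equations*, CUP 1995, §7.5,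
  Thm. 7.5, (7.5.4) and its proof (book pp. 152–153); §6.2 Lemma 6.2. [DoeringGibbon1995]
* J. T. Beale, T. Kato, A. Majda, Comm. Math. Phys. 94 (1984), 61–66, (15). [BealeKatoMajda1984]
* A. J. Majda, A. L. Bertozzi, *Vorticity and Incompressible Flow*, CUP 2002, §3.3, (3.83).
  [MajdaBertozzi2002]
-/

noncomputable section

open MeasureTheory Set Function Filter Metric Real
open _root_.Topology
open scoped NNReal ENNReal ContDiff

namespace Literature.Analysis.FunctionSpaces

namespace Torus

open UnitAddTorus

/-! ### Lemmas: Poincaré, `‖∇u‖₂ = ‖ω‖₂`, degenerate fields, elementary logarithms -/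

/-- Poincaré for smooth mean-zero fields: `4π² ∫‖v‖² ≤ ‖∇v‖₂²` (the tree's spectral Poincaré
inequality read for a smooth field). [folklore] -/
private theorem four_pi_sq_mul_integral_norm_sq_le {v : (UnitAddTorus (Fin 3)) → (EuclideanSpace ℝ (Fin 3))} (hv : IsSmooth v)
    (h0 : HasZeroMean v) : 4 * Real.pi ^ 2 * ∫ x, ‖v x‖ ^ 2 ≤ gradNormSq v := by
  have h1 := FluidPDE.ofReal_integral_norm_sq_le_eGradNormSq_add (hv.memLp 2)
  have h0' : ∫ x, v x = 0 := h0
  rw [h0', norm_zero, zero_pow two_ne_zero, mul_zero, ENNReal.ofReal_zero, add_zero] at h1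
  rw [gradNormSq_eq_toReal_eGradNormSq_holds hv]
  exact (ENNReal.ofReal_le_iff_le_toReal (eGradNormSq_lt_top hv).ne).1 h1

/-- `‖u‖₂ ≤ Ω` for a smooth divergence-free mean-zero field with `|curl u|² ≤ Ω²`
(`4π²‖u‖₂² ≤ ‖∇u‖₂² = ∫|curl u|² ≤ Ω²`, `|T³| = 1`, `4π² ≥ 1`). [folklore] -/
private theorem sqrt_integral_norm_sq_le_of_vorticityBound {u : (UnitAddTorus (Fin 3)) → (EuclideanSpace ℝ (Fin 3))} (hu : IsSmooth u)
    (hdiv : IsDivFree u) (h0 : HasZeroMean u) {Ω : ℝ} (hΩ0 : 0 ≤ Ω)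
    (hΩ : ∀ x, FluidPDE.torusVorticitySqAt u x ≤ Ω ^ 2) :
    Real.sqrt (∫ x, ‖u x‖ ^ 2) ≤ Ω := by
  have hP := four_pi_sq_mul_integral_norm_sq_le hu h0
  have hH1 : gradNormSq u ≤ Ω ^ 2 := by
    rw [FluidPDE.gradNormSq_eq_two_mul_torusEnstrophy,
      ← FluidPDE.integral_torusVorticitySqAt_eq_two_mul_torusEnstrophy hu hdiv]
    calc ∫ x, FluidPDE.torusVorticitySqAt u x ≤ ∫ _x : (UnitAddTorus (Fin 3)), Ω ^ 2 :=
          integral_mono_of_nonneg (Eventually.of_forall fun x => FluidPDE.torusVorticitySqAt_nonneg u x)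
            (integrable_const _) (Eventually.of_forall hΩ)
      _ = Ω ^ 2 := by simp
  have hI0 : 0 ≤ ∫ x, ‖u x‖ ^ 2 := integral_nonneg fun x => sq_nonneg _
  have hπ : 1 ≤ 4 * Real.pi ^ 2 := by nlinarith [Real.pi_gt_three]
  have hle : ∫ x, ‖u x‖ ^ 2 ≤ Ω ^ 2 := by nlinarith
  calc Real.sqrt (∫ x, ‖u x‖ ^ 2) ≤ Real.sqrt (Ω ^ 2) := Real.sqrt_le_sqrt hle
    _ = Ω := Real.sqrt_sq hΩ0

/-- `‖∇u‖₂² ≤ Ω²` for a smooth divergence-free field with `|curl u|² ≤ Ω²` (`‖∇u‖₂² = ∫|curl u|²`,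
`|T³| = 1`). [folklore] -/
private theorem gradNormSq_le_sq_of_vorticityBound {u : (UnitAddTorus (Fin 3)) → (EuclideanSpace ℝ (Fin 3))} (hu : IsSmooth u)
    (hdiv : IsDivFree u) {Ω : ℝ} (hΩ : ∀ x, FluidPDE.torusVorticitySqAt u x ≤ Ω ^ 2) :
    gradNormSq u ≤ Ω ^ 2 := by
  rw [FluidPDE.gradNormSq_eq_two_mul_torusEnstrophy,
    ← FluidPDE.integral_torusVorticitySqAt_eq_two_mul_torusEnstrophy hu hdiv]
  calc ∫ x, FluidPDE.torusVorticitySqAt u x ≤ ∫ _x : (UnitAddTorus (Fin 3)), Ω ^ 2 :=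
        integral_mono_of_nonneg (Eventually.of_forall fun x => FluidPDE.torusVorticitySqAt_nonneg u x)
          (integrable_const _) (Eventually.of_forall hΩ)
    _ = Ω ^ 2 := by simp

/-- The Haar probability measure of `T³` charges open sets. [folklore] -/
private theorem volume_isOpenPosMeasure : (volume : Measure (UnitAddTorus (Fin 3))).IsOpenPosMeasure := by
  rw [volume_pi]; infer_instance

/-- **Degenerate fields**: if `‖∇u‖₂² = 0` then `∇u ≡ 0` pointwise (a continuous nonnegative
function with zero integral vanishes). [folklore] -/
private theorem sum_norm_sq_partialDeriv_eq_zero {u : (UnitAddTorus (Fin 3)) → (EuclideanSpace ℝ (Fin 3))} (hu : IsSmooth u)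
    (h : gradNormSq u = 0) (x : (UnitAddTorus (Fin 3))) : ∑ i, ‖partialDeriv i u x‖ ^ 2 = 0 := by
  haveI := volume_isOpenPosMeasure
  set g : (UnitAddTorus (Fin 3)) → ℝ := fun x => ∑ i, ‖partialDeriv i u x‖ ^ 2 with hg
  have hgc : Continuous g :=
    continuous_finsetSum _ fun i _ => ((hu.partialDeriv i).continuous.norm).pow 2
  have hg0 : ∀ x, 0 ≤ g x := fun x => Finset.sum_nonneg fun i _ => sq_nonneg _
  have hint : ∫ x, g x = 0 := h
  have hae : g =ᵐ[volume] 0 :=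
    (integral_eq_zero_iff_of_nonneg (fun x => hg0 x) hgc.integrable_unitAddTorus).1 hint
  have heq : g = 0 := (Continuous.ae_eq_iff_eq volume hgc continuous_const).1 hae
  exact congrFun heq x

/-- `4π² ‖∇u‖₂² ≤ ‖Δu‖₂²` for smooth `u` (Poincaré for each mean-zero `∂ᵢu`, and
`∑ᵢ‖∇∂ᵢu‖₂² = ‖Δu‖₂²`). [folklore] -/
private theorem four_pi_sq_mul_gradNormSq_le_laplacian {u : (UnitAddTorus (Fin 3)) → (EuclideanSpace ℝ (Fin 3))} (hu : IsSmooth u) :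
    4 * Real.pi ^ 2 * gradNormSq u ≤ ∫ x, ‖laplacian u x‖ ^ 2 := by
  have hi : ∀ i : Fin 3, 4 * Real.pi ^ 2 * ∫ x, ‖partialDeriv i u x‖ ^ 2 ≤ gradNormSq (partialDeriv i u) :=
    fun i => four_pi_sq_mul_integral_norm_sq_le (hu.partialDeriv i) (hasZeroMean_partialDeriv hu i)
  have hsum : gradNormSq u = ∑ i, ∫ x, ‖partialDeriv i u x‖ ^ 2 := by
    rw [gradNormSq, integral_finsetSum _ (f := fun i x => ‖partialDeriv i u x‖ ^ 2)
      fun i _ => ((hu.partialDeriv i).continuous.norm.pow 2).integrable_unitAddTorus]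
  have hlap : ∑ i, gradNormSq (partialDeriv i u) = ∫ x, ‖laplacian u x‖ ^ 2 := by
    rw [← integral_sum_sum_norm_partialDeriv_partialDeriv_sq_eq hu]
    rw [integral_finsetSum _ (f := fun m x => ∑ i, ‖partialDeriv i (partialDeriv m u) x‖ ^ 2)
      fun m _ => (continuous_finsetSum _ fun i _ =>
        (((hu.partialDeriv m).partialDeriv i).continuous.norm).pow 2).integrable_unitAddTorus]
    rfl
  rw [hsum, Finset.mul_sum, ← hlap]
  exact Finset.sum_le_sum fun i _ => hi i

/-- `log(1 + √q) ≤ log 2 + ½ log⁺ q` for `q ≥ 0`. [folklore] -/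
private theorem log_one_add_sqrt_le {q : ℝ} (hq : 0 ≤ q) :
    Real.log (1 + Real.sqrt q) ≤ Real.log 2 + 2⁻¹ * max 0 (Real.log q) := by
  have hs0 : 0 ≤ Real.sqrt q := Real.sqrt_nonneg q
  rcases le_or_gt q 1 with h | h
  · have hs1 : Real.sqrt q ≤ 1 := Real.sqrt_le_one.mpr h |>.trans le_rfl
    calc Real.log (1 + Real.sqrt q) ≤ Real.log 2 :=
          Real.log_le_log (by positivity) (by linarith)
      _ ≤ Real.log 2 + 2⁻¹ * max 0 (Real.log q) := by
          have : 0 ≤ max 0 (Real.log q) := le_max_left _ _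
          linarith
  · have hq0 : 0 < q := lt_trans zero_lt_one h
    have hs1 : 1 ≤ Real.sqrt q := by
      rw [← Real.sqrt_one]; exact Real.sqrt_le_sqrt h.le
    have hspos : 0 < Real.sqrt q := lt_of_lt_of_le zero_lt_one hs1
    calc Real.log (1 + Real.sqrt q) ≤ Real.log (2 * Real.sqrt q) :=
          Real.log_le_log (by positivity) (by linarith)
      _ = Real.log 2 + 2⁻¹ * Real.log q := by
          rw [Real.log_mul (by norm_num) hspos.ne', Real.log_sqrt hq]; ring
      _ ≤ Real.log 2 + 2⁻¹ * max 0 (Real.log q) := by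
          have : Real.log q ≤ max 0 (Real.log q) := le_max_right _ _
          linarith

/-- `log(1 + q) ≤ log 2 + log⁺ q` for `q ≥ 0`. [folklore] -/
private theorem log_one_add_le {q : ℝ} (hq : 0 ≤ q) :
    Real.log (1 + q) ≤ Real.log 2 + max 0 (Real.log q) := by
  rcases le_or_gt q 1 with h | h
  · calc Real.log (1 + q) ≤ Real.log 2 := Real.log_le_log (by positivity) (by linarith)
      _ ≤ Real.log 2 + max 0 (Real.log q) := by
          have : 0 ≤ max 0 (Real.log q) := le_max_left _ _
          linarith
  · have hq0 : 0 < q := lt_trans zero_lt_one h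
    calc Real.log (1 + q) ≤ Real.log (2 * q) := Real.log_le_log (by positivity) (by linarith)
      _ = Real.log 2 + Real.log q := Real.log_mul (by norm_num) hq0.ne'
      _ ≤ Real.log 2 + max 0 (Real.log q) := by
          have : Real.log q ≤ max 0 (Real.log q) := le_max_right _ _
          linarith

/-! ### Theorem 7.5 with `κ_{3,1}` (enstrophy-based wavenumber) -/

/-- **Doering–Gibbon 1995, Thm. 7.5, `N = 3`, `r = 1`, unit torus.** There is an absolute constant
`c > 0` such that for every smooth divergence-free mean-zero `u : T³ → ℝ³`, every `Ω ≥ 0` with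
`|curl u(x)|² ≤ Ω²` for all `x`, and every `x`,

  `(∑ᵢ‖∂ᵢu(x)‖²)^{1/2} ≤ c Ω [1 + ¼ log⁺(H₃/H₁)] + ‖curl u‖₂`,

`H₁ = ‖∇u‖₂² = gradNormSq u`, `H₃ = ‖∇Δu‖₂² = gradNormSq (Δu)`, `log⁺ = max 0 ∘ log` — i.e.
`‖Du‖_∞ ≤ c‖ω‖_∞[1 + log⁺ κ_{3,1}] + ‖ω‖₂` with `κ_{3,1} = (H₃/H₁)^{1/4}`, `L = 1`.
[cite: DoeringGibbon1995, §7.5 Thm. 7.5, eq. (7.5.4) (N = 3, r = 1; book pp. 152–153)] -/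
theorem exists_sqrt_gradSq_le_bkm_kappa31 :
    ∃ c : ℝ, 0 < c ∧ ∀ (u : (UnitAddTorus (Fin 3)) → (EuclideanSpace ℝ (Fin 3))), IsSmooth u → IsDivFree u → HasZeroMean u →
      ∀ Ω : ℝ, 0 ≤ Ω → (∀ x, FluidPDE.torusVorticitySqAt u x ≤ Ω ^ 2) → ∀ x : (UnitAddTorus (Fin 3)),
        Real.sqrt (∑ i, ‖partialDeriv i u x‖ ^ 2) ≤
          c * Ω * (1 + 4⁻¹ * max 0 (Real.log (gradNormSq (laplacian u) / gradNormSq u))) +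
            Real.sqrt (∫ z, FluidPDE.torusVorticitySqAt u z) := by
  obtain ⟨C, hC, h⟩ := exists_sqrt_gradSq_le_bkm_log_homogeneous
  refine ⟨3 * C, by positivity, fun u hu hdiv h0 Ω hΩ0 hΩ x => ?_⟩
  set H1 : ℝ := gradNormSq u with hH1
  set D3 : ℝ := gradNormSq (laplacian u) with hD3
  set L : ℝ := max 0 (Real.log (D3 / H1)) with hL
  have hL0 : 0 ≤ L := le_max_left _ _
  have hW0 : 0 ≤ Real.sqrt (∫ z, FluidPDE.torusVorticitySqAt u z) := Real.sqrt_nonneg _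
  have hH10 : 0 ≤ H1 := by
    rw [hH1, gradNormSq]; exact integral_nonneg fun x => Finset.sum_nonneg fun i _ => sq_nonneg _
  have hD30 : 0 ≤ D3 := by
    rw [hD3, gradNormSq]; exact integral_nonneg fun x => Finset.sum_nonneg fun i _ => sq_nonneg _
  have hRHS0 : 0 ≤ 3 * C * Ω * (1 + 4⁻¹ * L) := by positivity
  -- degenerate case `H₁ = 0`: `∇u ≡ 0`
  rcases eq_or_lt_of_le hH10 with hz | hpos
  · rw [sum_norm_sq_partialDeriv_eq_zero hu hz.symm x, Real.sqrt_zero]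
    positivity
  -- generic case: `0 < H₁ ≤ Ω²`, so `Ω > 0`
  have hH1Ω : H1 ≤ Ω ^ 2 := gradNormSq_le_sq_of_vorticityBound hu hdiv hΩ
  have hΩpos : 0 < Ω := by
    rcases eq_or_lt_of_le hΩ0 with hΩz | hΩp
    · exfalso; rw [← hΩz] at hH1Ω; nlinarith
    · exact hΩp
  have hmain := h u hu hdiv Ω hΩpos hΩ x
  have hU : Real.sqrt (∫ z, ‖u z‖ ^ 2) ≤ Ω :=
    sqrt_integral_norm_sq_le_of_vorticityBound hu hdiv h0 hΩ0 hΩ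
  -- `√H₃/Ω ≤ √(H₃/H₁)`
  have hsH1 : 0 < Real.sqrt H1 := Real.sqrt_pos.2 hpos
  have hsH1Ω : Real.sqrt H1 ≤ Ω := by
    calc Real.sqrt H1 ≤ Real.sqrt (Ω ^ 2) := Real.sqrt_le_sqrt hH1Ω
      _ = Ω := Real.sqrt_sq hΩ0
  have hratio : Real.sqrt D3 / Ω ≤ Real.sqrt (D3 / H1) := by
    rw [Real.sqrt_div hD30]
    exact div_le_div_of_nonneg_left (Real.sqrt_nonneg _) hsH1 hsH1Ω
  have hq0 : 0 ≤ D3 / H1 := div_nonneg hD30 hH10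
  have hlog : Real.log (1 + Real.sqrt D3 / Ω) ≤ Real.log 2 + 2⁻¹ * L := by
    calc Real.log (1 + Real.sqrt D3 / Ω) ≤ Real.log (1 + Real.sqrt (D3 / H1)) :=
          Real.log_le_log (by positivity) (by linarith)
      _ ≤ Real.log 2 + 2⁻¹ * max 0 (Real.log (D3 / H1)) := log_one_add_sqrt_le hq0
  have hlog2 : Real.log 2 ≤ 1 := by
    have := Real.log_le_sub_one_of_pos (show (0 : ℝ) < 2 by norm_num); linarith
  have hlognn : 0 ≤ Real.log (1 + Real.sqrt D3 / Ω) := Real.log_nonneg (by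
    have : 0 ≤ Real.sqrt D3 / Ω := div_nonneg (Real.sqrt_nonneg _) hΩ0
    linarith)
  calc Real.sqrt (∑ i, ‖partialDeriv i u x‖ ^ 2)
      ≤ C * (Ω * (1 + Real.log (1 + Real.sqrt D3 / Ω)) + Real.sqrt (∫ z, ‖u z‖ ^ 2)) := hmain
    _ ≤ C * (Ω * (1 + (1 + 2⁻¹ * L)) + Ω) := by
        gcongr
        linarith
    _ ≤ 3 * C * Ω * (1 + 4⁻¹ * L) := by nlinarith [mul_nonneg hΩ0 hL0, hC.le]
    _ ≤ 3 * C * Ω * (1 + 4⁻¹ * L) + Real.sqrt (∫ z, FluidPDE.torusVorticitySqAt u z) := by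
        linarith

/-! ### Theorem 7.5 with `κ_{3,2}` (palinstrophy-based wavenumber) -/

/-- **Doering–Gibbon 1995, Thm. 7.5, `N = 3`, `r = 2`, unit torus.** There is an absolute constant
`c > 0` such that for every smooth divergence-free mean-zero `u : T³ → ℝ³`, every `Ω ≥ 0` with
`|curl u(x)|² ≤ Ω²` for all `x`, and every `x`,

  `(∑ᵢ‖∂ᵢu(x)‖²)^{1/2} ≤ c Ω [1 + ½ log⁺(H₃/H₂)] + ‖curl u‖₂`,

`H₂ = ‖Δu‖₂² = ∫‖Δu‖²` (the palinstrophy), `H₃ = ‖∇Δu‖₂² = gradNormSq (Δu)` — i.e.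
`‖Du‖_∞ ≤ c‖ω‖_∞[1 + log⁺ κ_{3,2}] + ‖ω‖₂` with `κ_{3,2} = (H₃/H₂)^{1/2}`, `L = 1`. (From the `r = 1`
mechanism and the interpolation `H₂² ≤ H₁H₃`, Doering–Gibbon Lemma 6.2.)
[cite: DoeringGibbon1995, §7.5 Thm. 7.5, eq. (7.5.4) (N = 3, r = 2; book pp. 152–153)] -/
theorem exists_sqrt_gradSq_le_bkm_kappa32 :
    ∃ c : ℝ, 0 < c ∧ ∀ (u : (UnitAddTorus (Fin 3)) → (EuclideanSpace ℝ (Fin 3))), IsSmooth u → IsDivFree u → HasZeroMean u →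
      ∀ Ω : ℝ, 0 ≤ Ω → (∀ x, FluidPDE.torusVorticitySqAt u x ≤ Ω ^ 2) → ∀ x : (UnitAddTorus (Fin 3)),
        Real.sqrt (∑ i, ‖partialDeriv i u x‖ ^ 2) ≤
          c * Ω * (1 + 2⁻¹ * max 0 (Real.log (gradNormSq (laplacian u) / ∫ z, ‖laplacian u z‖ ^ 2))) +
            Real.sqrt (∫ z, FluidPDE.torusVorticitySqAt u z) := by
  obtain ⟨C, hC, h⟩ := exists_sqrt_gradSq_le_bkm_log_homogeneous
  refine ⟨3 * C, by positivity, fun u hu hdiv h0 Ω hΩ0 hΩ x => ?_⟩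
  set H1 : ℝ := gradNormSq u with hH1
  set H2 : ℝ := ∫ z, ‖laplacian u z‖ ^ 2 with hH2
  set D3 : ℝ := gradNormSq (laplacian u) with hD3
  set L : ℝ := max 0 (Real.log (D3 / H2)) with hL
  have hL0 : 0 ≤ L := le_max_left _ _
  have hW0 : 0 ≤ Real.sqrt (∫ z, FluidPDE.torusVorticitySqAt u z) := Real.sqrt_nonneg _
  have hH10 : 0 ≤ H1 := by
    rw [hH1, gradNormSq]; exact integral_nonneg fun x => Finset.sum_nonneg fun i _ => sq_nonneg _
  have hH20 : 0 ≤ H2 := by rw [hH2]; exact integral_nonneg fun x => sq_nonneg _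
  have hD30 : 0 ≤ D3 := by
    rw [hD3, gradNormSq]; exact integral_nonneg fun x => Finset.sum_nonneg fun i _ => sq_nonneg _
  have hRHS0 : 0 ≤ 3 * C * Ω * (1 + 2⁻¹ * L) := by positivity
  -- degenerate case `H₁ = 0`: `∇u ≡ 0`
  rcases eq_or_lt_of_le hH10 with hz | hpos
  · rw [sum_norm_sq_partialDeriv_eq_zero hu hz.symm x, Real.sqrt_zero]
    positivity
  -- generic case: `0 < H₁ ≤ Ω²`, `0 < H₂` (Poincaré for `∇u`), `H₂² ≤ H₁ H₃`
  have hH1Ω : H1 ≤ Ω ^ 2 := gradNormSq_le_sq_of_vorticityBound hu hdiv hΩ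
  have hΩpos : 0 < Ω := by
    rcases eq_or_lt_of_le hΩ0 with hΩz | hΩp
    · exfalso; rw [← hΩz] at hH1Ω; nlinarith
    · exact hΩp
  have hH2pos : 0 < H2 := by
    have hP := four_pi_sq_mul_gradNormSq_le_laplacian hu
    have : 0 < 4 * Real.pi ^ 2 * H1 := by positivity
    exact lt_of_lt_of_le this hP
  have hint : H2 ^ 2 ≤ H1 * D3 := sq_integral_norm_sq_laplacian_le hu
  have hmain := h u hu hdiv Ω hΩpos hΩ x
  have hU : Real.sqrt (∫ z, ‖u z‖ ^ 2) ≤ Ω :=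
    sqrt_integral_norm_sq_le_of_vorticityBound hu hdiv h0 hΩ0 hΩ
  -- `√H₃/Ω ≤ √(H₃/H₁) ≤ H₃/H₂`
  have hsH1 : 0 < Real.sqrt H1 := Real.sqrt_pos.2 hpos
  have hsH1Ω : Real.sqrt H1 ≤ Ω := by
    calc Real.sqrt H1 ≤ Real.sqrt (Ω ^ 2) := Real.sqrt_le_sqrt hH1Ω
      _ = Ω := Real.sqrt_sq hΩ0
  have hratio1 : Real.sqrt D3 / Ω ≤ Real.sqrt (D3 / H1) := by
    rw [Real.sqrt_div hD30]
    exact div_le_div_of_nonneg_left (Real.sqrt_nonneg _) hsH1 hsH1Ω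
  have hratio2 : Real.sqrt (D3 / H1) ≤ D3 / H2 := by
    have hq : D3 / H1 ≤ (D3 / H2) ^ 2 := by
      rw [div_pow, div_le_div_iff₀ hpos (by positivity)]
      nlinarith [mul_le_mul_of_nonneg_left hint hD30]
    calc Real.sqrt (D3 / H1) ≤ Real.sqrt ((D3 / H2) ^ 2) := Real.sqrt_le_sqrt hq
      _ = D3 / H2 := Real.sqrt_sq (div_nonneg hD30 hH20)
  have hq0 : 0 ≤ D3 / H2 := div_nonneg hD30 hH20
  have hlog : Real.log (1 + Real.sqrt D3 / Ω) ≤ Real.log 2 + L := by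
    calc Real.log (1 + Real.sqrt D3 / Ω) ≤ Real.log (1 + D3 / H2) :=
          Real.log_le_log (by positivity) (by linarith)
      _ ≤ Real.log 2 + max 0 (Real.log (D3 / H2)) := log_one_add_le hq0
  have hlog2 : Real.log 2 ≤ 1 := by
    have := Real.log_le_sub_one_of_pos (show (0 : ℝ) < 2 by norm_num); linarith
  calc Real.sqrt (∑ i, ‖partialDeriv i u x‖ ^ 2)
      ≤ C * (Ω * (1 + Real.log (1 + Real.sqrt D3 / Ω)) + Real.sqrt (∫ z, ‖u z‖ ^ 2)) := hmain
    _ ≤ C * (Ω * (1 + (1 + L)) + Ω) := by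
        gcongr
        linarith
    _ ≤ 3 * C * Ω * (1 + 2⁻¹ * L) := by nlinarith [mul_nonneg hΩ0 hL0, hC.le]
    _ ≤ 3 * C * Ω * (1 + 2⁻¹ * L) + Real.sqrt (∫ z, FluidPDE.torusVorticitySqAt u z) := by
        linarith


/-! ### The form consumed by the Functional-Mining cell (no mean condition, squared, `‖ω‖₂` absorbed) -/

/-- Partial derivatives ignore additive constants. [folklore] -/
private theorem partialDeriv_sub_const' (g : (UnitAddTorus (Fin 3)) → (EuclideanSpace ℝ (Fin 3)))
    (c : EuclideanSpace ℝ (Fin 3)) (j : Fin 3) :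
    partialDeriv j (fun y => g y - c) = partialDeriv j g := by
  funext x
  simp only [Torus.partialDeriv, Torus.lineDeriv, deriv_sub_const]

/-- The Laplacian ignores additive constants (smooth fields). [folklore] -/
private theorem laplacian_sub_const' {g : (UnitAddTorus (Fin 3)) → (EuclideanSpace ℝ (Fin 3))}
    (hg : IsSmooth g) (c : EuclideanSpace ℝ (Fin 3)) :
    laplacian (fun y => g y - c) = laplacian g := by
  have hgc : IsSmooth (fun y => g y - c) := hg.sub (isSmooth_const c)
  funext x
  rw [laplacian_eq_sum_partialDeriv_partialDeriv hgc, laplacian_eq_sum_partialDeriv_partialDeriv hg]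
  simp only [partialDeriv_sub_const' g c]

/-- The vorticity magnitude ignores additive constants. [folklore] -/
private theorem torusVorticitySqAt_sub_const (g : (UnitAddTorus (Fin 3)) → (EuclideanSpace ℝ (Fin 3)))
    (c : EuclideanSpace ℝ (Fin 3)) (x : UnitAddTorus (Fin 3)) :
    FluidPDE.torusVorticitySqAt (fun y => g y - c) x = FluidPDE.torusVorticitySqAt g x := by
  simp only [FluidPDE.torusVorticitySqAt, partialDeriv_sub_const' g c]

/-- **Doering–Gibbon 1995, Thm. 7.5 (`N = 3`, `r = 2`, `L = 1`) in the majorant form consumed by the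
Functional-Mining cell** (`Summit.NavierStokesRegularity.FunctionalMining.BKMLogGradientBound c` at
`d := Fin 3`): there is `c > 0` such that for every smooth divergence-free `v : T³ → ℝ³` (no mean
condition), every `M ≥ 0` with `|curl v(x)|² ≤ M²` for all `x`, and every `x`,

  `∑ᵢ ‖∂ᵢv(x)‖² ≤ ( c · M · (1 + log⁺(H₃/H₂)) )²`,  `H₃ = gradNormSq (Δv)`, `H₂ = ∫‖Δv‖²`,

`log⁺ = max 0 ∘ log`. From `exists_sqrt_gradSq_le_bkm_kappa32` applied to `v − ∫v` (the gradient, the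
vorticity, `Δv` are unchanged) with `‖curl v‖₂ ≤ M` on the unit torus and `½ log⁺ ≤ log⁺` absorbed.
[cite: DoeringGibbon1995, §7.5 Thm. 7.5, eq. (7.5.4) (N = 3, r = 2; book pp. 152–153)] -/
theorem exists_gradSq_le_sq_bkm_posLog_ratio :
    ∃ c : ℝ, 0 < c ∧ ∀ (v : (UnitAddTorus (Fin 3)) → (EuclideanSpace ℝ (Fin 3))), IsSmooth v → IsDivFree v →
      ∀ M : ℝ, 0 ≤ M → (∀ x, FluidPDE.torusVorticitySqAt v x ≤ M ^ 2) → ∀ x : (UnitAddTorus (Fin 3)),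
        ∑ i, ‖partialDeriv i v x‖ ^ 2 ≤
          (c * M * (1 + max 0 (Real.log (gradNormSq (laplacian v) / ∫ z, ‖laplacian v z‖ ^ 2)))) ^ 2 := by
  obtain ⟨c₀, hc₀, h⟩ := exists_sqrt_gradSq_le_bkm_kappa32
  refine ⟨c₀ + 1, by positivity, fun v hv hdiv M hM0 hM x => ?_⟩
  -- pass to the mean-free field `w = v − ∫ v`
  set m : EuclideanSpace ℝ (Fin 3) := ∫ z, v z with hm
  set w : (UnitAddTorus (Fin 3)) → (EuclideanSpace ℝ (Fin 3)) := fun y => v y - m with hw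
  have hws : IsSmooth w := hv.sub (isSmooth_const m)
  have hDw : ∀ j, partialDeriv j w = partialDeriv j v := fun j => partialDeriv_sub_const' v m j
  have hLw : laplacian w = laplacian v := laplacian_sub_const' hv m
  have hVw : ∀ y, FluidPDE.torusVorticitySqAt w y = FluidPDE.torusVorticitySqAt v y :=
    fun y => torusVorticitySqAt_sub_const v m y
  have hwdiv : IsDivFree w := by
    intro y
    have h1 : divergence w y = divergence v y := by
      simp only [divergence]
      refine Finset.sum_congr rfl fun i _ => ?_
      have : (fun z => w z i) = fun z => v z i - m i := by
        funext z; simp [hw]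
      rw [this]
      simp only [Torus.partialDeriv, Torus.lineDeriv, deriv_sub_const]
    rw [h1]; exact hdiv y
  have hw0 : HasZeroMean w := by
    unfold HasZeroMean
    rw [hw]
    simp only
    rw [integral_sub hv.continuous.integrable_unitAddTorus (integrable_const _), integral_const]
    simp [hm]
  have hMw : ∀ y, FluidPDE.torusVorticitySqAt w y ≤ M ^ 2 := fun y => by rw [hVw]; exact hM y
  have hmain := h w hws hwdiv hw0 M hM0 hMw x
  simp only [hDw, hLw, hVw] at hmain
  -- `hmain : √(∑‖∂ᵢv x‖²) ≤ c₀ M (1 + ½ L) + √(∫ |curl v|²)`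
  set L : ℝ := max 0 (Real.log (gradNormSq (laplacian v) / ∫ z, ‖laplacian v z‖ ^ 2)) with hL
  have hL0 : 0 ≤ L := le_max_left _ _
  have hW : Real.sqrt (∫ z, FluidPDE.torusVorticitySqAt v z) ≤ M := by
    have hI : ∫ z, FluidPDE.torusVorticitySqAt v z ≤ M ^ 2 := by
      calc ∫ z, FluidPDE.torusVorticitySqAt v z ≤ ∫ _z : (UnitAddTorus (Fin 3)), M ^ 2 :=
            integral_mono_of_nonneg (Eventually.of_forall fun z => FluidPDE.torusVorticitySqAt_nonneg v z)
              (integrable_const _) (Eventually.of_forall hM)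
        _ = M ^ 2 := by simp
    calc Real.sqrt (∫ z, FluidPDE.torusVorticitySqAt v z) ≤ Real.sqrt (M ^ 2) := Real.sqrt_le_sqrt hI
      _ = M := Real.sqrt_sq hM0
  have hS0 : 0 ≤ ∑ i, ‖partialDeriv i v x‖ ^ 2 := Finset.sum_nonneg fun i _ => sq_nonneg _
  have hB : Real.sqrt (∑ i, ‖partialDeriv i v x‖ ^ 2) ≤ (c₀ + 1) * M * (1 + L) := by
    calc Real.sqrt (∑ i, ‖partialDeriv i v x‖ ^ 2)
        ≤ c₀ * M * (1 + 2⁻¹ * L) + Real.sqrt (∫ z, FluidPDE.torusVorticitySqAt v z) := hmain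
      _ ≤ c₀ * M * (1 + 2⁻¹ * L) + M := by linarith
      _ ≤ (c₀ + 1) * M * (1 + L) := by nlinarith [mul_nonneg hM0 hL0, mul_nonneg hc₀.le (mul_nonneg hM0 hL0)]
  have hB0 : 0 ≤ (c₀ + 1) * M * (1 + L) := by positivity
  calc ∑ i, ‖partialDeriv i v x‖ ^ 2 = Real.sqrt (∑ i, ‖partialDeriv i v x‖ ^ 2) ^ 2 :=
        (Real.sq_sqrt hS0).symm
    _ ≤ ((c₀ + 1) * M * (1 + L)) ^ 2 := pow_le_pow_left₀ (Real.sqrt_nonneg _) hB 2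

end Torus

end Literature.Analysis.FunctionSpaces

end
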